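import Summits.HodgeConjecture.HodgeConjecture.Theorems.K2E1SelfDualResidueClassMemCharLineOfLettersCMTwo   -- ★ p862022 (this seat, (B) PART 2): dictionary `trivialDatum_letters_of_chiSection_detTwist`; brings ★ (B) PART 1 p861962 (`coe_apply_out_inv_eq_quotientFun_inv`), ★ T2 FINAL `residue_detTwist_eq_const_mul_level_cm_two`, ★ p861677
import Summits.HodgeConjecture.HodgeConjecture.Theorems.K2E1ChiEisensteinDetTwistU2                         -- ★ (K2E1-p06): the det-twist transport `differentiableOn_twist` … `truncation_twist`, `pole_letter_twist`, `automorphicCharacter_adelicUnipotent_mul`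
import HarnessLib

/-!
# R90-TF · S8 «ContSpec-n½» — `R90S8ResidueAtomIsCharacterClassU2`: THE PER-ATOM RESIDUE LETTER (R) OF THE #4′ ASSEMBLY
# — the residue class at `z = 1` of a `det`-type block of `U(1,1)_{L∕L⁺}` is a.e. `x ↦ r·Θ((out x)⁻¹)`, from the BLOCK's own letters (the untwist transport to ★ T2 FINAL)

Cell `hodgecm-mathlib`, crux H413 (`stmt-HodgeConjecture-24833`, lane `--supports … --as helper`), route of record `HCCMUnconditional`; R90-TF section S8, deal S8-R48 (3) (R90-CS-plan
(g2)) «(R) per-atom discharge → K2E2-p12 (g8)».  Consumer: the visible (R) letter of the H7 assembly (K2E1-p14), i.e. the `he` binder of ★ p862513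
`R90S8ResHResiduesAreCharLinesU2.hL_resHAtom_of_atoms`: `∃ (Θ : QS.AutomorphicCharacter) (r : ℂ), ⇑(e ℓ b i) =ᵐ[μ] fun x => r * Θ((Quotient.out x)⁻¹)` for each atom `e ℓ b i` =
the residue class at `z = 1` of a block family (K2E1-p16's H8 currency `e (c, a)`: by ★ (β2) p862111 `eq_one_and_char_eq_one_of_residue_ne_zero_cm` a genuine pole `c` of a self-dual
block has `c = 1` and `χ₀ = 1`, and by ★ p861677 `cm_exists_cmDetChar_borel_eq_two` such a block is `χ = (χ̃_ψ)⁻¹` for an automorphic `ψ` of `U(1)` — both used BY NAME by the presenter,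
not restated).  THEOREMS ONLY (no `def`, no `instance`, no notation, no named-fact hypothesis, no `sorry`; default heartbeats); count-neutral; generic level datum `(K', ω)`.

THE MATHEMATICS ([MoeglinWaldspurger1995, IV.1.11]; [Rogawski1990, §13.9 (i) p. 229]).  Let `Θ = ψ∘det` and `χ = (χ̃_ψ)⁻¹`.  A χ-section `φ ∈ V(χ, K′, ω)` is `Θ·φ₁` with `φ₁` a section of
the TRIVIAL datum carrying T2's four section letters (★ dictionary).  The continued χ-family `Ẽ_χ(z) = E(φ, z)` untwists to the trivial-datum family `Ẽ(z) := Ẽ_χ(z)·Θ⁻¹ = E(φ₁, z)`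
(★ `eisensteinSeriesU_flatSectionU_mul_automorphicCharacter`), and every LAYER-2 letter transports through the unitary multiplier `Θ⁻¹` (★ `K2E1ChiEisensteinDetTwistU2`: holomorphy,
continuity, local bounds, `G(F)`-invariance, the constant term — `Θ` kills `N(𝔸)` — the truncation and the pole letter; the `L²` family through the isometry `M_Θ` of ★ `AutomorphicTwist`).
The block's scattering-residue letter «`(z−1)·ψ_χ(z, g) → r·Θ(g)`» becomes T2's «`(z−1)·ψ(z, g) → r`».  ★ T2 FINAL `residue_detTwist_eq_const_mul_level_cm_two` then gives
`Res_{z=1} Ẽ_χ(z)(g) = r·Θ(g)` for every pole letter of `Ẽ_χ = Ẽ·Θ`, and the `L²` class `f =ᵐ x ↦ Res((out x)⁻¹)` is a.e. `r·Θ((out x)⁻¹)`.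
* §1 `ae_eq_const_mul_detChar_of_levelLetters`, `exists_ae_eq_const_mul_of_levelLetters` — (R) in T2-FINAL currency (trivial-datum family + twist `Θ`): corollaries of ★ T2 FINAL.
* §2 **`ae_eq_const_mul_detChar_of_chiBlockLetters`**, **`exists_ae_eq_const_mul_of_chiBlockLetters`** — (R) in BLOCK currency: the untwist transport (new content) + §1.
HONEST LABEL: HC_CM is proved only modulo the 7 printed citations (2 remaining named inputs: hLiu418 = `stmt-HodgeConjecture-24832`, h413 = `stmt-HodgeConjecture-24833`) until rung 0
closes; count-neutral helper; closes no socket; after this file the (R) letter of #4′ is discharged modulo the block-family letters themselves (G9) and, at the presenter, `hsrc` (Q-S1).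

## References
* [MoeglinWaldspurger1995] C. Mœglin, J.-L. Waldspurger, *Spectral Decomposition and Eisenstein Series* (1995), IV.1.11 (residues of rank-one Eisenstein series), II.1.7 (constant terms).
* [Rogawski1990] J. D. Rogawski, *Automorphic Representations of Unitary Groups in Three Variables* (1990), §13.9 (i) p. 229.
-/

set_option autoImplicit false
-- the mandated namespace repeats the single-problem summit's segment (`HodgeConjecture.HodgeConjecture`)
set_option linter.dupNamespace false

noncomputable section

open MeasureTheory Measure NumberField IsDedekindDomain Set Filter Topology Metric
open scoped ENNReal NNReal
open Literature.NumberTheory.Automorphic Literature.NumberTheory.Automorphic.UnitaryGroup AdelicGroupData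
open Literature.NumberTheory.Automorphic.Arthur2013.Leaves.TECR
open Literature.NumberTheory.GaloisRepresentations (HeckeCharacter)
open Summit.HodgeConjecture.HodgeConjecture.Cruxes.H413.K2E1BorelEisensteinU
open Summit.HodgeConjecture.HodgeConjecture.Cruxes.H413.K2E1BLBorelSpacesU2Defs
open Summit.HodgeConjecture.HodgeConjecture.Cruxes.H413.K2E1CharacterEisensteinU2Defs
open Summit.HodgeConjecture.HodgeConjecture.Cruxes.H413.K2E1ChiSectionSpaceU2Defs
open Summit.HodgeConjecture.HodgeConjecture.Cruxes.H413.K2E1ChiEisensteinDetTwistU2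
open Summit.HodgeConjecture.HodgeConjecture.Cruxes.H413.K2E1SelfDualResidueAtomMemCharLineCMTwo (coe_apply_out_inv_eq_quotientFun_inv)
open Summit.HodgeConjecture.HodgeConjecture.Cruxes.H413.K2E1SelfDualResidueClassMemCharLineOfLettersCMTwo (trivialDatum_letters_of_chiSection_detTwist)
open Summit.HodgeConjecture.HodgeConjecture.Cruxes.H413.K2E1EisensteinResidueLevelConstantU2Final (residue_detTwist_eq_const_mul_level_cm_two)

namespace Summit.HodgeConjecture.HodgeConjecture.R90.S8

variable (L : Type) [Field L] [NumberField L] [IsCMField L]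
variable [MeasurableSpace (quasiSplit (↥(maximalRealSubfield L)) L (IsCMField.complexConj L) 2).Adelic] [BorelSpace (quasiSplit (↥(maximalRealSubfield L)) L (IsCMField.complexConj L) 2).Adelic]
  (μ : Measure (quasiSplit (↥(maximalRealSubfield L)) L (IsCMField.complexConj L) 2).automorphicQuotient) [(quasiSplit (↥(maximalRealSubfield L)) L (IsCMField.complexConj L) 2).IsAutomorphicMeasure μ]

/-! ## §1 (R) in T2-FINAL currency: the trivial-datum level family twisted by `Θ` -/

/-- **(R), T2-FINAL CURRENCY**: for the trivial-datum level family `Ẽ` (T2 FINAL's binders VERBATIM), a unitary automorphic character `Θ`, ANY pole letter `Fp'` of `Ẽ·Θ` at `z = 1` and an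
`L²` class `f =ᵐ x ↦ Fp' ((out x)⁻¹) 1` (the residue class in the `out⁻¹` convention): `f =ᵐ x ↦ r·Θ((out x)⁻¹)`, `r` the scattering residue (★ T2 FINAL `residue_detTwist_eq_const_mul_level_cm_two`).
[cite: MoeglinWaldspurger1995, IV.1.11] [cite: Rogawski1990, §13.9 (i) p. 229] -/
theorem ae_eq_const_mul_detChar_of_levelLetters
    (ν : Measure ↥(adelicUnipotent (↥(maximalRealSubfield L)) L (IsCMField.complexConj L) 2)) [ν.IsHaarMeasure]
    {𝓕 : Set ↥(adelicUnipotent (↥(maximalRealSubfield L)) L (IsCMField.complexConj L) 2)}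
    (h𝓕N : IsFundamentalDomain ↥(rationalUnipotent (↥(maximalRealSubfield L)) L (IsCMField.complexConj L) 2) 𝓕 ν) (h𝓕c : IsCompact (closure 𝓕))
    {φ₁ : (quasiSplit (↥(maximalRealSubfield L)) L (IsCMField.complexConj L) 2).Adelic → ℂ} (hφc : Continuous φ₁) {M : ℝ} (hφM : ∀ x, ‖φ₁ x‖ ≤ M)
    (hφN : ∀ (u : ↥(adelicUnipotent (↥(maximalRealSubfield L)) L (IsCMField.complexConj L) 2)) (x : (quasiSplit (↥(maximalRealSubfield L)) L (IsCMField.complexConj L) 2).Adelic),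
      φ₁ ((u : (quasiSplit (↥(maximalRealSubfield L)) L (IsCMField.complexConj L) 2).Adelic) * x) = φ₁ x)
    (hφB : ∀ b ∈ borelU ((IsCMField.complexConj L : L ≃ₐ[↥(maximalRealSubfield L)] L) : L →+* L) ((StdForm.antidiagonal 2).over L),
      ∀ x : (quasiSplit (↥(maximalRealSubfield L)) L (IsCMField.complexConj L) 2).Adelic,
        φ₁ ((quasiSplit (↥(maximalRealSubfield L)) L (IsCMField.complexConj L) 2).toAdelic b * x) = φ₁ x)
    {T : ℝ≥0} (hT : 1 ≤ T)
    (Ec : ℂ → (quasiSplit (↥(maximalRealSubfield L)) L (IsCMField.complexConj L) 2).Adelic → ℂ) {D : Set ℂ} (hDo : IsOpen D) (hDc : IsPreconnected D)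
    {σ₀ : ℝ} (hσ₀ : 1 < σ₀) (hσD : ∀ᶠ z in 𝓝 ((σ₀ : ℝ) : ℂ), z ∈ D) {ρ : ℝ} (hρ : 0 < ρ) (hρD : ∀ z : ℂ, z ≠ 1 → dist z 1 < ρ → z ∈ D)
    (hEd : ∀ g, DifferentiableOn ℂ (fun z => Ec z g) D) (hE4 : ∀ z ∈ D, Continuous (Ec z))
    (hEbd : ∀ z₀ ∈ D, ∀ K : Set (quasiSplit (↥(maximalRealSubfield L)) L (IsCMField.complexConj L) 2).Adelic, IsCompact K → ∃ V ∈ 𝓝 z₀, ∃ M : ℝ, ∀ z ∈ V, ∀ g ∈ K, ‖Ec z g‖ ≤ M)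
    (hEcinv : ∀ z ∈ D, ∀ (γ : (quasiSplit (↥(maximalRealSubfield L)) L (IsCMField.complexConj L) 2).arithmeticSubgroup) (x : (quasiSplit (↥(maximalRealSubfield L)) L (IsCMField.complexConj L) 2).Adelic),
      Ec z ((γ : (quasiSplit (↥(maximalRealSubfield L)) L (IsCMField.complexConj L) 2).Adelic) * x) = Ec z x)
    (hE2 : ∀ z ∈ D, 1 < z.re → Ec z = eisensteinSeriesU (flatSectionU φ₁ z))
    (ψ : ℂ → (quasiSplit (↥(maximalRealSubfield L)) L (IsCMField.complexConj L) 2).Adelic → ℂ) {r : ℂ}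
    (hψ : ∀ g : (quasiSplit (↥(maximalRealSubfield L)) L (IsCMField.complexConj L) 2).Adelic, Tendsto (fun z : ℂ => (z - 1) * ψ z g) (𝓝[≠] 1) (𝓝 r))
    (hE3 : ∀ z ∈ D, ∀ g : (quasiSplit (↥(maximalRealSubfield L)) L (IsCMField.complexConj L) 2).Adelic,
      borelConstantTerm ν 𝓕 (Ec z) g = φ₁ g * (((borelHeight g : ℝ≥0) : ℝ) : ℂ) ^ z + ψ z g * (((borelHeight g : ℝ≥0) : ℝ) : ℂ) ^ (1 - z))
    (Fp : (quasiSplit (↥(maximalRealSubfield L)) L (IsCMField.complexConj L) 2).Adelic → ℂ → ℂ) (hF : ∀ g, AnalyticAt ℂ (Fp g) 1) (hFE : ∀ g, Fp g =ᶠ[𝓝[≠] 1] fun z => (z - 1) * Ec z g)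
    (Fam : ℂ → (quasiSplit (↥(maximalRealSubfield L)) L (IsCMField.complexConj L) 2).L2 μ) (hFd : DifferentiableOn ℂ Fam D)
    (hFam : ∀ z ∈ D, ((Fam z : (quasiSplit (↥(maximalRealSubfield L)) L (IsCMField.complexConj L) 2).L2 μ) : (quasiSplit (↥(maximalRealSubfield L)) L (IsCMField.complexConj L) 2).automorphicQuotient → ℂ) =ᵐ[μ]
      (quasiSplit (↥(maximalRealSubfield L)) L (IsCMField.complexConj L) 2).quotFun (truncation ν 𝓕 T (Ec z)))
    (Res : (quasiSplit (↥(maximalRealSubfield L)) L (IsCMField.complexConj L) 2).L2 μ) (hRes : Tendsto (fun z : ℂ => (z - 1) • Fam z) (𝓝[≠] 1) (𝓝 Res))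
    (Θ : (quasiSplit (↥(maximalRealSubfield L)) L (IsCMField.complexConj L) 2).AutomorphicCharacter)
    (Fp' : (quasiSplit (↥(maximalRealSubfield L)) L (IsCMField.complexConj L) 2).Adelic → ℂ → ℂ) (hF' : ∀ g, AnalyticAt ℂ (Fp' g) 1)
    (hFE' : ∀ g, Fp' g =ᶠ[𝓝[≠] 1] fun z => (z - 1) * (Ec z g * ((Θ g : ℂˣ) : ℂ)))
    (f : (quasiSplit (↥(maximalRealSubfield L)) L (IsCMField.complexConj L) 2).L2 μ)
    (hf : (f : (quasiSplit (↥(maximalRealSubfield L)) L (IsCMField.complexConj L) 2).automorphicQuotient → ℂ) =ᵐ[μ] fun x => Fp' (Quotient.out (x : (quasiSplit (↥(maximalRealSubfield L)) L (IsCMField.complexConj L) 2).Adelic ⧸ (quasiSplit (↥(maximalRealSubfield L)) L (IsCMField.complexConj L) 2).quotientSubgroup))⁻¹ 1) :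
    (f : (quasiSplit (↥(maximalRealSubfield L)) L (IsCMField.complexConj L) 2).automorphicQuotient → ℂ) =ᵐ[μ] fun x => r * ((Θ (Quotient.out (x : (quasiSplit (↥(maximalRealSubfield L)) L (IsCMField.complexConj L) 2).Adelic ⧸ (quasiSplit (↥(maximalRealSubfield L)) L (IsCMField.complexConj L) 2).quotientSubgroup))⁻¹ : ℂˣ) : ℂ) := by
  have hres := residue_detTwist_eq_const_mul_level_cm_two L μ ν h𝓕N h𝓕c hφc hφM hφN hφB hT Ec hDo hDc hσ₀ hσD hρ hρD hEd hE4 hEbd hEcinv hE2 ψ hψ hE3 Fp hF hFE Fam hFd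
    hFam Res hRes Θ Fp' hF' hFE'
  exact hf.trans (Filter.Eventually.of_forall fun x => hres _)

/-- **(R), T2-FINAL CURRENCY, `∃`-FORM** — the `he` binder of ★ `hL_resHAtom_of_atoms` for this atom. [cite: MoeglinWaldspurger1995, IV.1.11] [cite: Rogawski1990, §13.9 (i) p. 229] -/
theorem exists_ae_eq_const_mul_of_levelLetters
    (ν : Measure ↥(adelicUnipotent (↥(maximalRealSubfield L)) L (IsCMField.complexConj L) 2)) [ν.IsHaarMeasure]
    {𝓕 : Set ↥(adelicUnipotent (↥(maximalRealSubfield L)) L (IsCMField.complexConj L) 2)}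
    (h𝓕N : IsFundamentalDomain ↥(rationalUnipotent (↥(maximalRealSubfield L)) L (IsCMField.complexConj L) 2) 𝓕 ν) (h𝓕c : IsCompact (closure 𝓕))
    {φ₁ : (quasiSplit (↥(maximalRealSubfield L)) L (IsCMField.complexConj L) 2).Adelic → ℂ} (hφc : Continuous φ₁) {M : ℝ} (hφM : ∀ x, ‖φ₁ x‖ ≤ M)
    (hφN : ∀ (u : ↥(adelicUnipotent (↥(maximalRealSubfield L)) L (IsCMField.complexConj L) 2)) (x : (quasiSplit (↥(maximalRealSubfield L)) L (IsCMField.complexConj L) 2).Adelic),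
      φ₁ ((u : (quasiSplit (↥(maximalRealSubfield L)) L (IsCMField.complexConj L) 2).Adelic) * x) = φ₁ x)
    (hφB : ∀ b ∈ borelU ((IsCMField.complexConj L : L ≃ₐ[↥(maximalRealSubfield L)] L) : L →+* L) ((StdForm.antidiagonal 2).over L),
      ∀ x : (quasiSplit (↥(maximalRealSubfield L)) L (IsCMField.complexConj L) 2).Adelic,
        φ₁ ((quasiSplit (↥(maximalRealSubfield L)) L (IsCMField.complexConj L) 2).toAdelic b * x) = φ₁ x)
    {T : ℝ≥0} (hT : 1 ≤ T)
    (Ec : ℂ → (quasiSplit (↥(maximalRealSubfield L)) L (IsCMField.complexConj L) 2).Adelic → ℂ) {D : Set ℂ} (hDo : IsOpen D) (hDc : IsPreconnected D)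
    {σ₀ : ℝ} (hσ₀ : 1 < σ₀) (hσD : ∀ᶠ z in 𝓝 ((σ₀ : ℝ) : ℂ), z ∈ D) {ρ : ℝ} (hρ : 0 < ρ) (hρD : ∀ z : ℂ, z ≠ 1 → dist z 1 < ρ → z ∈ D)
    (hEd : ∀ g, DifferentiableOn ℂ (fun z => Ec z g) D) (hE4 : ∀ z ∈ D, Continuous (Ec z))
    (hEbd : ∀ z₀ ∈ D, ∀ K : Set (quasiSplit (↥(maximalRealSubfield L)) L (IsCMField.complexConj L) 2).Adelic, IsCompact K → ∃ V ∈ 𝓝 z₀, ∃ M : ℝ, ∀ z ∈ V, ∀ g ∈ K, ‖Ec z g‖ ≤ M)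
    (hEcinv : ∀ z ∈ D, ∀ (γ : (quasiSplit (↥(maximalRealSubfield L)) L (IsCMField.complexConj L) 2).arithmeticSubgroup) (x : (quasiSplit (↥(maximalRealSubfield L)) L (IsCMField.complexConj L) 2).Adelic),
      Ec z ((γ : (quasiSplit (↥(maximalRealSubfield L)) L (IsCMField.complexConj L) 2).Adelic) * x) = Ec z x)
    (hE2 : ∀ z ∈ D, 1 < z.re → Ec z = eisensteinSeriesU (flatSectionU φ₁ z))
    (ψ : ℂ → (quasiSplit (↥(maximalRealSubfield L)) L (IsCMField.complexConj L) 2).Adelic → ℂ) {r : ℂ}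
    (hψ : ∀ g : (quasiSplit (↥(maximalRealSubfield L)) L (IsCMField.complexConj L) 2).Adelic, Tendsto (fun z : ℂ => (z - 1) * ψ z g) (𝓝[≠] 1) (𝓝 r))
    (hE3 : ∀ z ∈ D, ∀ g : (quasiSplit (↥(maximalRealSubfield L)) L (IsCMField.complexConj L) 2).Adelic,
      borelConstantTerm ν 𝓕 (Ec z) g = φ₁ g * (((borelHeight g : ℝ≥0) : ℝ) : ℂ) ^ z + ψ z g * (((borelHeight g : ℝ≥0) : ℝ) : ℂ) ^ (1 - z))
    (Fp : (quasiSplit (↥(maximalRealSubfield L)) L (IsCMField.complexConj L) 2).Adelic → ℂ → ℂ) (hF : ∀ g, AnalyticAt ℂ (Fp g) 1) (hFE : ∀ g, Fp g =ᶠ[𝓝[≠] 1] fun z => (z - 1) * Ec z g)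
    (Fam : ℂ → (quasiSplit (↥(maximalRealSubfield L)) L (IsCMField.complexConj L) 2).L2 μ) (hFd : DifferentiableOn ℂ Fam D)
    (hFam : ∀ z ∈ D, ((Fam z : (quasiSplit (↥(maximalRealSubfield L)) L (IsCMField.complexConj L) 2).L2 μ) : (quasiSplit (↥(maximalRealSubfield L)) L (IsCMField.complexConj L) 2).automorphicQuotient → ℂ) =ᵐ[μ]
      (quasiSplit (↥(maximalRealSubfield L)) L (IsCMField.complexConj L) 2).quotFun (truncation ν 𝓕 T (Ec z)))
    (Res : (quasiSplit (↥(maximalRealSubfield L)) L (IsCMField.complexConj L) 2).L2 μ) (hRes : Tendsto (fun z : ℂ => (z - 1) • Fam z) (𝓝[≠] 1) (𝓝 Res))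
    (Θ : (quasiSplit (↥(maximalRealSubfield L)) L (IsCMField.complexConj L) 2).AutomorphicCharacter)
    (Fp' : (quasiSplit (↥(maximalRealSubfield L)) L (IsCMField.complexConj L) 2).Adelic → ℂ → ℂ) (hF' : ∀ g, AnalyticAt ℂ (Fp' g) 1)
    (hFE' : ∀ g, Fp' g =ᶠ[𝓝[≠] 1] fun z => (z - 1) * (Ec z g * ((Θ g : ℂˣ) : ℂ)))
    (f : (quasiSplit (↥(maximalRealSubfield L)) L (IsCMField.complexConj L) 2).L2 μ)
    (hf : (f : (quasiSplit (↥(maximalRealSubfield L)) L (IsCMField.complexConj L) 2).automorphicQuotient → ℂ) =ᵐ[μ] fun x => Fp' (Quotient.out (x : (quasiSplit (↥(maximalRealSubfield L)) L (IsCMField.complexConj L) 2).Adelic ⧸ (quasiSplit (↥(maximalRealSubfield L)) L (IsCMField.complexConj L) 2).quotientSubgroup))⁻¹ 1) :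
    ∃ (Θ' : (quasiSplit (↥(maximalRealSubfield L)) L (IsCMField.complexConj L) 2).AutomorphicCharacter) (r' : ℂ),
      (f : (quasiSplit (↥(maximalRealSubfield L)) L (IsCMField.complexConj L) 2).automorphicQuotient → ℂ) =ᵐ[μ] fun x => r' * ((Θ' (Quotient.out (x : (quasiSplit (↥(maximalRealSubfield L)) L (IsCMField.complexConj L) 2).Adelic ⧸ (quasiSplit (↥(maximalRealSubfield L)) L (IsCMField.complexConj L) 2).quotientSubgroup))⁻¹ : ℂˣ) : ℂ) :=
  ⟨Θ, r, ae_eq_const_mul_detChar_of_levelLetters L μ ν h𝓕N h𝓕c hφc hφM hφN hφB hT Ec hDo hDc hσ₀ hσD hρ hρD hEd hE4 hEbd hEcinv hE2 ψ hψ hE3 Fp hF hFE Fam hFd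
    hFam Res hRes Θ Fp' hF' hFE' f hf⟩

/-! ## §2 (R) in BLOCK currency: the untwist transport -/

/-- **(R), BLOCK CURRENCY — THE UNTWIST TRANSPORT**: let `ψ` be an automorphic character of `U(1)_{L∕L⁺}`, `Θ = ψ∘det` (★ `cmDetChar`), `χ = (χ̃_ψ)⁻¹`, `φ ∈ V(χ, K′, ω)` continuous and
bounded (generic level datum), and let the block's continued family `Ẽ_χ` come with the LAYER-2 letters (holomorphy, continuity, local bounds, `G(F)`-invariance, `Ẽ_χ(z) = E(φ, z)` for
`Re z > 1`, constant term `φ·H^z + ψ_χ(z)·H^{1−z}` with SCATTERING RESIDUE `(z−1)·ψ_χ(z, g) → r·Θ(g)`, a pole letter `Fp` at `z = 1`, the `L²` truncation family `Fam` with residue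
`Res`).  Then the residue class `f =ᵐ x ↦ Fp((out x)⁻¹) 1` is a.e. `x ↦ r·Θ((out x)⁻¹)`.  Proof: untwist everything by `Θ⁻¹` (★ dictionary `φ = Θ·φ₁`; ★ `K2E1ChiEisensteinDetTwistU2`
transports; `M_Θ` of ★ `AutomorphicTwist` on the `L²` family) and apply §1 to `Ẽ := Ẽ_χ·Θ⁻¹` with the twisted pole letter `Fp` of `Ẽ·Θ = Ẽ_χ`. [cite: MoeglinWaldspurger1995, IV.1.11] [cite: Rogawski1990, §13.9 (i) p. 229] -/
theorem ae_eq_const_mul_detChar_of_chiBlockLetters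
    (ν : Measure ↥(adelicUnipotent (↥(maximalRealSubfield L)) L (IsCMField.complexConj L) 2)) [ν.IsHaarMeasure]
    {𝓕 : Set ↥(adelicUnipotent (↥(maximalRealSubfield L)) L (IsCMField.complexConj L) 2)}
    (h𝓕N : IsFundamentalDomain ↥(rationalUnipotent (↥(maximalRealSubfield L)) L (IsCMField.complexConj L) 2) 𝓕 ν) (h𝓕c : IsCompact (closure 𝓕))
    (ψU : ↥(TorusDict.torus (IsCMField.complexConj L)) →ₜ* ℂˣ) (hψU : TorusDict.IsAutomorphic (IsCMField.complexConj L) ψU)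
    {K' : Subgroup (quasiSplit (↥(maximalRealSubfield L)) L (IsCMField.complexConj L) 2).Adelic} {ω : ↥K' → ℂ}
    {φ : (quasiSplit (↥(maximalRealSubfield L)) L (IsCMField.complexConj L) 2).Adelic → ℂ}
    (hφ : φ ∈ chiSectionSpace (TorusDict.pullback (IsCMField.complexConj L) (Algebra.IsQuadraticExtension.finrank_eq_two _ L) (IsCMField.complexConj_ne_one L) ψU hψU)⁻¹ K' ω)
    (hφc : Continuous φ) {M : ℝ} (hφM : ∀ x, ‖φ x‖ ≤ M)
    {T : ℝ≥0} (hT : 1 ≤ T)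
    (Ec : ℂ → (quasiSplit (↥(maximalRealSubfield L)) L (IsCMField.complexConj L) 2).Adelic → ℂ) {D : Set ℂ} (hDo : IsOpen D) (hDc : IsPreconnected D)
    {σ₀ : ℝ} (hσ₀ : 1 < σ₀) (hσD : ∀ᶠ z in 𝓝 ((σ₀ : ℝ) : ℂ), z ∈ D) {ρ : ℝ} (hρ : 0 < ρ) (hρD : ∀ z : ℂ, z ≠ 1 → dist z 1 < ρ → z ∈ D)
    (hEd : ∀ g, DifferentiableOn ℂ (fun z => Ec z g) D) (hE4 : ∀ z ∈ D, Continuous (Ec z))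
    (hEbd : ∀ z₀ ∈ D, ∀ K : Set (quasiSplit (↥(maximalRealSubfield L)) L (IsCMField.complexConj L) 2).Adelic, IsCompact K → ∃ V ∈ 𝓝 z₀, ∃ M : ℝ, ∀ z ∈ V, ∀ g ∈ K, ‖Ec z g‖ ≤ M)
    (hEcinv : ∀ z ∈ D, ∀ (γ : (quasiSplit (↥(maximalRealSubfield L)) L (IsCMField.complexConj L) 2).arithmeticSubgroup) (x : (quasiSplit (↥(maximalRealSubfield L)) L (IsCMField.complexConj L) 2).Adelic),
      Ec z ((γ : (quasiSplit (↥(maximalRealSubfield L)) L (IsCMField.complexConj L) 2).Adelic) * x) = Ec z x)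
    (hE2 : ∀ z ∈ D, 1 < z.re → Ec z = eisensteinSeriesU (flatSectionU φ z))
    (ψs : ℂ → (quasiSplit (↥(maximalRealSubfield L)) L (IsCMField.complexConj L) 2).Adelic → ℂ) {r : ℂ}
    (hψ : ∀ g : (quasiSplit (↥(maximalRealSubfield L)) L (IsCMField.complexConj L) 2).Adelic, Tendsto (fun z : ℂ => (z - 1) * ψs z g) (𝓝[≠] 1) (𝓝 (r * (((cmDetChar L 2 ((StdForm.antidiagonal 2).over L) ψU hψU ((Matrix.isUnit_iff_isUnit_det _).mp (StdForm.isUnit_over (StdForm.antidiagonal 2) L)).ne_zero) g : ℂˣ) : ℂ))))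
    (hE3 : ∀ z ∈ D, ∀ g : (quasiSplit (↥(maximalRealSubfield L)) L (IsCMField.complexConj L) 2).Adelic,
      borelConstantTerm ν 𝓕 (Ec z) g = φ g * (((borelHeight g : ℝ≥0) : ℝ) : ℂ) ^ z + ψs z g * (((borelHeight g : ℝ≥0) : ℝ) : ℂ) ^ (1 - z))
    (Fp : (quasiSplit (↥(maximalRealSubfield L)) L (IsCMField.complexConj L) 2).Adelic → ℂ → ℂ) (hF : ∀ g, AnalyticAt ℂ (Fp g) 1) (hFE : ∀ g, Fp g =ᶠ[𝓝[≠] 1] fun z => (z - 1) * Ec z g)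
    (Fam : ℂ → (quasiSplit (↥(maximalRealSubfield L)) L (IsCMField.complexConj L) 2).L2 μ) (hFd : DifferentiableOn ℂ Fam D)
    (hFam : ∀ z ∈ D, ((Fam z : (quasiSplit (↥(maximalRealSubfield L)) L (IsCMField.complexConj L) 2).L2 μ) : (quasiSplit (↥(maximalRealSubfield L)) L (IsCMField.complexConj L) 2).automorphicQuotient → ℂ) =ᵐ[μ]
      (quasiSplit (↥(maximalRealSubfield L)) L (IsCMField.complexConj L) 2).quotFun (truncation ν 𝓕 T (Ec z)))
    (Res : (quasiSplit (↥(maximalRealSubfield L)) L (IsCMField.complexConj L) 2).L2 μ) (hRes : Tendsto (fun z : ℂ => (z - 1) • Fam z) (𝓝[≠] 1) (𝓝 Res))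
    (f : (quasiSplit (↥(maximalRealSubfield L)) L (IsCMField.complexConj L) 2).L2 μ)
    (hf : (f : (quasiSplit (↥(maximalRealSubfield L)) L (IsCMField.complexConj L) 2).automorphicQuotient → ℂ) =ᵐ[μ] fun x => Fp (Quotient.out (x : (quasiSplit (↥(maximalRealSubfield L)) L (IsCMField.complexConj L) 2).Adelic ⧸ (quasiSplit (↥(maximalRealSubfield L)) L (IsCMField.complexConj L) 2).quotientSubgroup))⁻¹ 1) :
    (f : (quasiSplit (↥(maximalRealSubfield L)) L (IsCMField.complexConj L) 2).automorphicQuotient → ℂ) =ᵐ[μ] fun x => r * (((cmDetChar L 2 ((StdForm.antidiagonal 2).over L) ψU hψU ((Matrix.isUnit_iff_isUnit_det _).mp (StdForm.isUnit_over (StdForm.antidiagonal 2) L)).ne_zero) (Quotient.out (x : (quasiSplit (↥(maximalRealSubfield L)) L (IsCMField.complexConj L) 2).Adelic ⧸ (quasiSplit (↥(maximalRealSubfield L)) L (IsCMField.complexConj L) 2).quotientSubgroup))⁻¹ : ℂˣ) : ℂ) := by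
  set Θ : (quasiSplit (↥(maximalRealSubfield L)) L (IsCMField.complexConj L) 2).AutomorphicCharacter := (cmDetChar L 2 ((StdForm.antidiagonal 2).over L) ψU hψU ((Matrix.isUnit_iff_isUnit_det _).mp (StdForm.isUnit_over (StdForm.antidiagonal 2) L)).ne_zero) with hΘ
  -- the dictionary: `φ = Θ·φ₁`, `φ₁` a trivial-datum section with T2's four letters
  obtain ⟨φ₁, hφΘ, hφ₁c, hφ₁M, hφ₁N, hφ₁B⟩ := trivialDatum_letters_of_chiSection_detTwist L ψU hψU hφ hφc hφM
  have hΘ0 : ∀ g : (quasiSplit (↥(maximalRealSubfield L)) L (IsCMField.complexConj L) 2).Adelic, ((Θ g : ℂˣ) : ℂ) ≠ 0 := fun g => (Θ g).ne_zero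
  have hinv : ∀ g : (quasiSplit (↥(maximalRealSubfield L)) L (IsCMField.complexConj L) 2).Adelic, ((Θ⁻¹ g : ℂˣ) : ℂ) = (((Θ g : ℂˣ) : ℂ))⁻¹ := fun g => AutomorphicCharacter.coe_inv_apply Θ g
  have hφ₁eq : ∀ g : (quasiSplit (↥(maximalRealSubfield L)) L (IsCMField.complexConj L) 2).Adelic, φ g * ((Θ⁻¹ g : ℂˣ) : ℂ) = φ₁ g := fun g => by
    rw [hφΘ g, hinv, mul_comm (((Θ g : ℂˣ) : ℂ)), mul_assoc, mul_inv_cancel₀ (hΘ0 g), mul_one]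
  have hφ₁fun : (fun g : (quasiSplit (↥(maximalRealSubfield L)) L (IsCMField.complexConj L) 2).Adelic => φ g * ((Θ⁻¹ g : ℂˣ) : ℂ)) = φ₁ := funext hφ₁eq
  -- `Θ⁻¹` kills `N(𝔸)` and is left-`G(F)`-invariant
  have hθN := automorphicCharacter_adelicUnipotent_mul L (le_refl 2) Θ⁻¹
  have hθΓ := automorphicCharacter_arithmetic_mul Θ⁻¹
  -- T2 FINAL for the untwisted family `Ẽ := Ẽ_χ·Θ⁻¹`, twisted back by `Θ`
  have key := residue_detTwist_eq_const_mul_level_cm_two L μ ν h𝓕N h𝓕c hφ₁c hφ₁M hφ₁N hφ₁B hT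
    (fun z g => Ec z g * ((Θ⁻¹ g : ℂˣ) : ℂ)) hDo hDc hσ₀ hσD hρ hρD
    (differentiableOn_twist Ec hEd _) (continuous_twist Ec hE4 Θ⁻¹) (locally_bounded_twist Ec hEbd Θ⁻¹) (rational_invariant_twist Ec hEcinv Θ⁻¹)
    (fun z hz hre => by
      have h := eq_eisensteinSeriesU_flatSectionU_twist Ec hE2 Θ⁻¹ z hz hre
      rw [hφ₁fun] at h
      exact h)
    (fun z g => ψs z g * ((Θ⁻¹ g : ℂˣ) : ℂ))
    (fun g => by
      have hlim : r * ((Θ g : ℂˣ) : ℂ) * ((Θ⁻¹ g : ℂˣ) : ℂ) = r := by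
        rw [hinv, mul_assoc, mul_inv_cancel₀ (hΘ0 g), mul_one]
      have h := (hψ g).mul_const (((Θ⁻¹ g : ℂˣ) : ℂ))
      rw [hlim] at h
      exact h.congr' (Filter.Eventually.of_forall fun z => mul_assoc _ _ _))
    (fun z hz g => by
      show borelConstantTerm ν 𝓕 (fun x => Ec z x * ((Θ⁻¹ x : ℂˣ) : ℂ)) g =
        φ₁ g * (((borelHeight g : ℝ≥0) : ℝ) : ℂ) ^ z + ψs z g * ((Θ⁻¹ g : ℂˣ) : ℂ) * (((borelHeight g : ℝ≥0) : ℝ) : ℂ) ^ (1 - z)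
      rw [borelConstantTerm_mul_of_forall_unipotent_mul ν 𝓕 hθN g, hE3 z hz g, ← hφ₁eq g]
      ring)
    (fun g z => Fp g z * ((Θ⁻¹ g : ℂˣ) : ℂ)) (pole_letter_twist Ec Fp hF hFE _).1 (pole_letter_twist Ec Fp hF hFE _).2
    (fun z => Θ.mulL2 μ (Fam z)) ((Θ.mulL2Equiv μ).toContinuousLinearEquiv.differentiable.comp_differentiableOn hFd)
    (fun z hz => by
      filter_upwards [Θ.coeFn_mulL2 μ (Fam z), hFam z hz] with x h1 h2
      rw [h1, h2, truncation_twist ν 𝓕 T Ec hθΓ hθN z]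
      show Θ.quotientFun x * truncation ν 𝓕 T (Ec z) (Quotient.out (x : (quasiSplit (↥(maximalRealSubfield L)) L (IsCMField.complexConj L) 2).Adelic ⧸ (quasiSplit (↥(maximalRealSubfield L)) L (IsCMField.complexConj L) 2).quotientSubgroup))⁻¹ =
        truncation ν 𝓕 T (Ec z) (Quotient.out (x : (quasiSplit (↥(maximalRealSubfield L)) L (IsCMField.complexConj L) 2).Adelic ⧸ (quasiSplit (↥(maximalRealSubfield L)) L (IsCMField.complexConj L) 2).quotientSubgroup))⁻¹ * ((Θ⁻¹ (Quotient.out (x : (quasiSplit (↥(maximalRealSubfield L)) L (IsCMField.complexConj L) 2).Adelic ⧸ (quasiSplit (↥(maximalRealSubfield L)) L (IsCMField.complexConj L) 2).quotientSubgroup))⁻¹ : ℂˣ) : ℂ)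
      rw [hinv, coe_apply_out_inv_eq_quotientFun_inv Θ x, AutomorphicCharacter.quotientFun_inv, inv_inv, mul_comm])
    (Θ.mulL2 μ Res)
    (Filter.Tendsto.congr (fun z => Θ.mulL2_smul μ (z - 1) (Fam z)) ((((Θ.mulL2Equiv μ).continuous.tendsto Res).comp hRes)))
    Θ Fp hF
    (fun g => by
      filter_upwards [hFE g] with z hz
      rw [hz]
      show (z - 1) * Ec z g = (z - 1) * (Ec z g * ((Θ⁻¹ g : ℂˣ) : ℂ) * ((Θ g : ℂˣ) : ℂ))
      rw [hinv, mul_assoc (Ec z g), inv_mul_cancel₀ (hΘ0 g), mul_one])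
  exact hf.trans (Filter.Eventually.of_forall fun x => key _)

/-- **(R), BLOCK CURRENCY, `∃`-FORM** — the `he` binder of ★ `hL_resHAtom_of_atoms` for the residue class at `z = 1` of a `det`-type block, from the block's own letters.
[cite: MoeglinWaldspurger1995, IV.1.11] [cite: Rogawski1990, §13.9 (i) p. 229] -/
theorem exists_ae_eq_const_mul_of_chiBlockLetters
    (ν : Measure ↥(adelicUnipotent (↥(maximalRealSubfield L)) L (IsCMField.complexConj L) 2)) [ν.IsHaarMeasure]
    {𝓕 : Set ↥(adelicUnipotent (↥(maximalRealSubfield L)) L (IsCMField.complexConj L) 2)}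
    (h𝓕N : IsFundamentalDomain ↥(rationalUnipotent (↥(maximalRealSubfield L)) L (IsCMField.complexConj L) 2) 𝓕 ν) (h𝓕c : IsCompact (closure 𝓕))
    (ψU : ↥(TorusDict.torus (IsCMField.complexConj L)) →ₜ* ℂˣ) (hψU : TorusDict.IsAutomorphic (IsCMField.complexConj L) ψU)
    {K' : Subgroup (quasiSplit (↥(maximalRealSubfield L)) L (IsCMField.complexConj L) 2).Adelic} {ω : ↥K' → ℂ}
    {φ : (quasiSplit (↥(maximalRealSubfield L)) L (IsCMField.complexConj L) 2).Adelic → ℂ}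
    (hφ : φ ∈ chiSectionSpace (TorusDict.pullback (IsCMField.complexConj L) (Algebra.IsQuadraticExtension.finrank_eq_two _ L) (IsCMField.complexConj_ne_one L) ψU hψU)⁻¹ K' ω)
    (hφc : Continuous φ) {M : ℝ} (hφM : ∀ x, ‖φ x‖ ≤ M)
    {T : ℝ≥0} (hT : 1 ≤ T)
    (Ec : ℂ → (quasiSplit (↥(maximalRealSubfield L)) L (IsCMField.complexConj L) 2).Adelic → ℂ) {D : Set ℂ} (hDo : IsOpen D) (hDc : IsPreconnected D)
    {σ₀ : ℝ} (hσ₀ : 1 < σ₀) (hσD : ∀ᶠ z in 𝓝 ((σ₀ : ℝ) : ℂ), z ∈ D) {ρ : ℝ} (hρ : 0 < ρ) (hρD : ∀ z : ℂ, z ≠ 1 → dist z 1 < ρ → z ∈ D)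
    (hEd : ∀ g, DifferentiableOn ℂ (fun z => Ec z g) D) (hE4 : ∀ z ∈ D, Continuous (Ec z))
    (hEbd : ∀ z₀ ∈ D, ∀ K : Set (quasiSplit (↥(maximalRealSubfield L)) L (IsCMField.complexConj L) 2).Adelic, IsCompact K → ∃ V ∈ 𝓝 z₀, ∃ M : ℝ, ∀ z ∈ V, ∀ g ∈ K, ‖Ec z g‖ ≤ M)
    (hEcinv : ∀ z ∈ D, ∀ (γ : (quasiSplit (↥(maximalRealSubfield L)) L (IsCMField.complexConj L) 2).arithmeticSubgroup) (x : (quasiSplit (↥(maximalRealSubfield L)) L (IsCMField.complexConj L) 2).Adelic),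
      Ec z ((γ : (quasiSplit (↥(maximalRealSubfield L)) L (IsCMField.complexConj L) 2).Adelic) * x) = Ec z x)
    (hE2 : ∀ z ∈ D, 1 < z.re → Ec z = eisensteinSeriesU (flatSectionU φ z))
    (ψs : ℂ → (quasiSplit (↥(maximalRealSubfield L)) L (IsCMField.complexConj L) 2).Adelic → ℂ) {r : ℂ}
    (hψ : ∀ g : (quasiSplit (↥(maximalRealSubfield L)) L (IsCMField.complexConj L) 2).Adelic, Tendsto (fun z : ℂ => (z - 1) * ψs z g) (𝓝[≠] 1) (𝓝 (r * (((cmDetChar L 2 ((StdForm.antidiagonal 2).over L) ψU hψU ((Matrix.isUnit_iff_isUnit_det _).mp (StdForm.isUnit_over (StdForm.antidiagonal 2) L)).ne_zero) g : ℂˣ) : ℂ))))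
    (hE3 : ∀ z ∈ D, ∀ g : (quasiSplit (↥(maximalRealSubfield L)) L (IsCMField.complexConj L) 2).Adelic,
      borelConstantTerm ν 𝓕 (Ec z) g = φ g * (((borelHeight g : ℝ≥0) : ℝ) : ℂ) ^ z + ψs z g * (((borelHeight g : ℝ≥0) : ℝ) : ℂ) ^ (1 - z))
    (Fp : (quasiSplit (↥(maximalRealSubfield L)) L (IsCMField.complexConj L) 2).Adelic → ℂ → ℂ) (hF : ∀ g, AnalyticAt ℂ (Fp g) 1) (hFE : ∀ g, Fp g =ᶠ[𝓝[≠] 1] fun z => (z - 1) * Ec z g)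
    (Fam : ℂ → (quasiSplit (↥(maximalRealSubfield L)) L (IsCMField.complexConj L) 2).L2 μ) (hFd : DifferentiableOn ℂ Fam D)
    (hFam : ∀ z ∈ D, ((Fam z : (quasiSplit (↥(maximalRealSubfield L)) L (IsCMField.complexConj L) 2).L2 μ) : (quasiSplit (↥(maximalRealSubfield L)) L (IsCMField.complexConj L) 2).automorphicQuotient → ℂ) =ᵐ[μ]
      (quasiSplit (↥(maximalRealSubfield L)) L (IsCMField.complexConj L) 2).quotFun (truncation ν 𝓕 T (Ec z)))
    (Res : (quasiSplit (↥(maximalRealSubfield L)) L (IsCMField.complexConj L) 2).L2 μ) (hRes : Tendsto (fun z : ℂ => (z - 1) • Fam z) (𝓝[≠] 1) (𝓝 Res))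
    (f : (quasiSplit (↥(maximalRealSubfield L)) L (IsCMField.complexConj L) 2).L2 μ)
    (hf : (f : (quasiSplit (↥(maximalRealSubfield L)) L (IsCMField.complexConj L) 2).automorphicQuotient → ℂ) =ᵐ[μ] fun x => Fp (Quotient.out (x : (quasiSplit (↥(maximalRealSubfield L)) L (IsCMField.complexConj L) 2).Adelic ⧸ (quasiSplit (↥(maximalRealSubfield L)) L (IsCMField.complexConj L) 2).quotientSubgroup))⁻¹ 1) :
    ∃ (Θ' : (quasiSplit (↥(maximalRealSubfield L)) L (IsCMField.complexConj L) 2).AutomorphicCharacter) (r' : ℂ),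
      (f : (quasiSplit (↥(maximalRealSubfield L)) L (IsCMField.complexConj L) 2).automorphicQuotient → ℂ) =ᵐ[μ] fun x => r' * ((Θ' (Quotient.out (x : (quasiSplit (↥(maximalRealSubfield L)) L (IsCMField.complexConj L) 2).Adelic ⧸ (quasiSplit (↥(maximalRealSubfield L)) L (IsCMField.complexConj L) 2).quotientSubgroup))⁻¹ : ℂˣ) : ℂ) :=
  ⟨(cmDetChar L 2 ((StdForm.antidiagonal 2).over L) ψU hψU ((Matrix.isUnit_iff_isUnit_det _).mp (StdForm.isUnit_over (StdForm.antidiagonal 2) L)).ne_zero), r, ae_eq_const_mul_detChar_of_chiBlockLetters L μ ν h𝓕N h𝓕c ψU hψU hφ hφc hφM hT Ec hDo hDc hσ₀ hσD hρ hρD hEd hE4 hEbd hEcinv hE2 ψs hψ hE3 Fp hF hFE Fam hFd hFam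
    Res hRes f hf⟩

end Summit.HodgeConjecture.HodgeConjecture.R90.S8

end
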